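import Mathlib
import Summits.NavierStokesRegularity.NavierStokesRegularity.Theorems.WakeRatchetAdmissibleEternalBoundDampedFedSpike
import Summits.NavierStokesRegularity.NavierStokesRegularity.Theorems.WakeRatchetAdmissibleEternalBoundPersistenceBlock
import HarnessLib

/-!
# The a-priori DISSIPATIVE SHELL STEP for admissible eternal solutions: above the dissipation cutoff
# the shell suprema contract quadratically (support for `WakeRatchet.AdmissibleEternalBound`,
# stmt-NavierStokesRegularity-23197)

* `dissipativeStep` — on a cancelling table, for an admissible eternal solution (any `ν̂ ≥ 0`) with
  per-shell action `≤ M`: `‖W_{k-1}‖ ≤ S` on `(-∞, σ₀]` implies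
  `‖W_k‖ ≤ ΛC_A e^{C_AM/Λ} S²/(1 + viscCoef(k, σ₀))` on `(-∞, σ₀]`.  This is the quadratic recursion of
  Tao's Lemma 4.1 / the tree's `physEnergy_succ_le` made A PRIORI: no type-I bound above the shell is
  assumed — the top flux is paid for by the ACTION of shell `k+1` through the Grönwall factor of the
  damped fed-spike fence (`WakeRatchetDampedFedSpike.gronwall_sq_fence_on`, weight `e^{(1+Γ)σ}`).
* `sup_le_div_two_pow_above_cutoff` — once the damping of the next shell beats the feed
  (`2ΛC_A e^{C_AM/Λ} S ≤ 1 + viscCoef(k₀+1, σ₀)`), the suprema halve shell by shell above `k₀`: the FAR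
  dissipation range is slaved to the cutoff layer.

With `WakeRatchetPersistence` (uniform bound at/below the cutoff for forward cascades) this leaves, of
the viscous part of the crux, exactly the HOT LAYER `1 ≲ viscCoef ≲ ΛC_A e^{C_AM/Λ}·(amplitude)` just
under the cutoff — the regime of a front riding the dissipation scale (what child (B) of the split
extracts).  MODEL lattice ODEs only (Tao 2016 §4, §6.4); nothing here concerns the Navier–Stokes
equations, and no summit or rung is proved.
-/

noncomputable section

set_option linter.dupNamespace false

namespace Summit.NavierStokesRegularity.NavierStokesRegularity.Theorems

namespace WakeRatchetDissipativeStep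

open Filter Topology MeasureTheory Set intervalIntegral
open scoped RealInnerProductSpace
open Literature.Analysis.FluidPDE Literature.Analysis.FluidPDE.TaoCascade
open WakeRatchetFedSpike WakeRatchetPersistenceBlock WakeRatchetDampedFedSpike

section Dissipative

variable {m : ℕ} {ε₀ νh : ℝ} {α : Fin m → Fin m → Fin m → ℤ × ℤ × ℤ → ℝ} {W : ℤ → ℝ → Em m}

/-- **THE DISSIPATIVE SHELL STEP (a priori).**  On a cancelling table, for an admissible eternal
solution (any `ν̂ ≥ 0`) with per-shell action `≤ M`: if `‖W_{k-1}‖ ≤ S` on `(-∞, σ₀]`, then on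
`(-∞, σ₀]`
`‖W_k‖ ≤ Λ C_A e^{C_A M/Λ} S² / (1 + viscCoef(k, σ₀))`.
This is the QUADRATIC recursion of Tao's Lemma 4.1 / the tree's `physEnergy_succ_le`, but A PRIORI:
no type-I bound above the shell is assumed (the top flux is paid for by the action of shell `k+1`
through the Grönwall factor, not by a bound; `gronwall_sq_fence_on` with the damped weight
`e^{(1+Γ)x}`, `Γ = viscCoef(k,σ)` the damping floor of the left half-line).  MODEL lattice only.
[cite: Tao2016AveragedNS, §4 Lemma 4.1 (4.8)–(4.10) with (4.3), the viscous equation before Thm. 4.2, §6.4; cell vocabulary (`IsEternalVisc`, `viscCoef`)] -/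
theorem dissipativeStep (hε : 0 < ε₀) (hc : IsCancellingCoeff α) (hW : IsEternalVisc ε₀ νh α W)
    {M : ℝ} (hM : ∀ n : ℤ, Integrable (fun σ => ‖W n σ‖) ∧ ∫ σ, ‖W n σ‖ ≤ M)
    (k : ℤ) {σ₀ S : ℝ} (hS : ∀ s, s ≤ σ₀ → ‖W (k - 1) s‖ ≤ S) :
    ∀ σ, σ ≤ σ₀ → ‖W k σ‖ ≤
      bigLam ε₀ * fluxConst α * Real.exp (fluxConst α * (bigLam ε₀)⁻¹ * M) * S ^ 2
        / (1 + viscCoef ε₀ νh k σ₀) := by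
  intro σ hσ
  have hS' := table_sTable α hc
  have hΛpos : 0 < bigLam ε₀ := bigLam_pos (by linarith)
  have hΛi : 0 ≤ (bigLam ε₀)⁻¹ := inv_nonneg.2 hΛpos.le
  have hCA : 0 ≤ fluxConst α := hS'.CA_nonneg
  have hM0 : 0 ≤ M := le_trans (integral_nonneg fun _ => norm_nonneg _) (hM 0).2
  have hWc : ∀ n : ℤ, Continuous (W n) := fun n =>
    continuous_iff_continuousAt.2 fun x => (hW.law n x).continuousAt
  have hv0 : ∀ j s, 0 ≤ viscCoef ε₀ νh j s := fun j s => by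
    unfold viscCoef; exact mul_nonneg hW.nonneg (by positivity)
  -- the damping floor `Γ = viscCoef(k, σ)` of the half-line `(-∞, σ]`
  set Γ : ℝ := viscCoef ε₀ νh k σ with hΓdef
  have hΓ0 : 0 ≤ Γ := hv0 k σ
  have hΓ1 : 0 < 1 + Γ := by linarith
  have hΓσ₀ : viscCoef ε₀ νh k σ₀ ≤ Γ := viscCoef_anti_time hε hW.nonneg k hσ
  have hv1 : 0 < 1 + viscCoef ε₀ νh k σ₀ := by linarith [hv0 k σ₀]
  set G : ℝ := Real.exp (fluxConst α * (bigLam ε₀)⁻¹ * M) with hGdef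
  have hG1 : 1 ≤ G := Real.one_le_exp (by positivity)
  have hSnn : 0 ≤ S := (norm_nonneg _).trans (hS σ₀ le_rfl)
  refine le_of_forall_pos_lt_add fun η hη => ?_
  obtain ⟨a, haσ, ha⟩ := exists_le_abs_lt (hM k).1 (show 0 < η / (2 * G) by positivity) σ
  rw [abs_of_nonneg (norm_nonneg _)] at ha
  have hWk := hWc k
  have hWkm := hWc (k - 1)
  have hWkp := hWc (k + 1)
  -- the damped fence on `[a, σ]`
  have hfs := gronwall_sq_fence_on (h := fun x => Real.exp ((1 + Γ) * x) * ‖W k x‖)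
    (src := fun x => bigLam ε₀ * fluxConst α * (Real.exp ((1 + Γ) * x) * ‖W (k - 1) x‖ ^ 2))
    (cof := fun x => ‖W (k + 1) x‖) (κ := fluxConst α * (bigLam ε₀)⁻¹) haσ
    (mul_nonneg hCA hΛi) (fun x => by positivity)
    (fun x => hasDerivAt_renE_damped hc hW k Γ x)
    (fun x hx => renE_damped_deriv_le hε hc W k (viscCoef_anti_time hε hW.nonneg k hx.2.le))
    (by fun_prop) (by fun_prop) (fun s => by positivity) (fun s => norm_nonneg _)
  -- the Grönwall factor
  have hI : ∫ s in a..σ, ‖W (k + 1) s‖ ≤ M :=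
    (intervalIntegral_le_integral (hM (k + 1)).1 (fun _ => norm_nonneg _) haσ).trans (hM (k + 1)).2
  have hexpG : Real.exp (fluxConst α * (bigLam ε₀)⁻¹ * ∫ s in a..σ, ‖W (k + 1) s‖) ≤ G :=
    Real.exp_le_exp.2 (mul_le_mul_of_nonneg_left hI (by positivity))
  -- the feed integral: `≤ Λ C_A S² e^{(1+Γ)σ}/(1+Γ)`
  have hfeed : ∫ s in a..σ, bigLam ε₀ * fluxConst α * (Real.exp ((1 + Γ) * s) * ‖W (k - 1) s‖ ^ 2)
      ≤ bigLam ε₀ * fluxConst α * S ^ 2 * (Real.exp ((1 + Γ) * σ) / (1 + Γ)) := by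
    have h1 : ∫ s in a..σ, bigLam ε₀ * fluxConst α * (Real.exp ((1 + Γ) * s) * ‖W (k - 1) s‖ ^ 2)
        ≤ ∫ s in a..σ, (bigLam ε₀ * fluxConst α * S ^ 2) * Real.exp ((1 + Γ) * s) := by
      refine intervalIntegral.integral_mono_on haσ ((by fun_prop : Continuous fun s =>
          bigLam ε₀ * fluxConst α * (Real.exp ((1 + Γ) * s) * ‖W (k - 1) s‖ ^ 2)).intervalIntegrable
            _ _)
        ((by fun_prop : Continuous fun s =>
          (bigLam ε₀ * fluxConst α * S ^ 2) * Real.exp ((1 + Γ) * s)).intervalIntegrable _ _) ?_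
      intro s hs
      have hWs : ‖W (k - 1) s‖ ≤ S := hS s (hs.2.trans hσ)
      have hsq : ‖W (k - 1) s‖ ^ 2 ≤ S ^ 2 := pow_le_pow_left₀ (norm_nonneg _) hWs 2
      have : Real.exp ((1 + Γ) * s) * ‖W (k - 1) s‖ ^ 2 ≤ S ^ 2 * Real.exp ((1 + Γ) * s) := by
        nlinarith [Real.exp_pos ((1 + Γ) * s)]
      calc bigLam ε₀ * fluxConst α * (Real.exp ((1 + Γ) * s) * ‖W (k - 1) s‖ ^ 2)
          ≤ bigLam ε₀ * fluxConst α * (S ^ 2 * Real.exp ((1 + Γ) * s)) :=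
            mul_le_mul_of_nonneg_left this (by positivity)
        _ = _ := by ring
    have h2 : ∫ s in a..σ, (bigLam ε₀ * fluxConst α * S ^ 2) * Real.exp ((1 + Γ) * s)
        = (bigLam ε₀ * fluxConst α * S ^ 2) * ∫ s in a..σ, Real.exp ((1 + Γ) * s) :=
      intervalIntegral.integral_const_mul _ _
    have h3 := integral_exp_mul_le hΓ1 a σ
    calc _ ≤ _ := h1
      _ = _ := h2
      _ ≤ bigLam ε₀ * fluxConst α * S ^ 2 * (Real.exp ((1 + Γ) * σ) / (1 + Γ)) :=
          mul_le_mul_of_nonneg_left h3 (by positivity)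
  -- the initial term
  have hinit : Real.exp ((1 + Γ) * a) * ‖W k a‖ ≤ Real.exp ((1 + Γ) * σ) * (η / (2 * G)) :=
    mul_le_mul (Real.exp_le_exp.2 (by nlinarith)) ha.le (norm_nonneg _) (Real.exp_pos _).le
  have hsum0 : 0 ≤ Real.exp ((1 + Γ) * a) * ‖W k a‖
      + ∫ s in a..σ, bigLam ε₀ * fluxConst α * (Real.exp ((1 + Γ) * s) * ‖W (k - 1) s‖ ^ 2) := by
    have : 0 ≤ ∫ s in a..σ, bigLam ε₀ * fluxConst α *
        (Real.exp ((1 + Γ) * s) * ‖W (k - 1) s‖ ^ 2) :=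
      intervalIntegral.integral_nonneg haσ fun s _ => by positivity
    positivity
  have hmain : Real.exp ((1 + Γ) * σ) * ‖W k σ‖
      ≤ G * (Real.exp ((1 + Γ) * σ) * (η / (2 * G))
        + bigLam ε₀ * fluxConst α * S ^ 2 * (Real.exp ((1 + Γ) * σ) / (1 + Γ))) :=
    hfs.trans (mul_le_mul hexpG (add_le_add hinit hfeed) hsum0 (by positivity))
  have hexpσ : 0 < Real.exp ((1 + Γ) * σ) := Real.exp_pos _
  have hdiv : ‖W k σ‖ ≤ G * (η / (2 * G)) + G * (bigLam ε₀ * fluxConst α * S ^ 2 / (1 + Γ)) := by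
    have e : G * (Real.exp ((1 + Γ) * σ) * (η / (2 * G))
        + bigLam ε₀ * fluxConst α * S ^ 2 * (Real.exp ((1 + Γ) * σ) / (1 + Γ)))
        = Real.exp ((1 + Γ) * σ) * (G * (η / (2 * G))
          + G * (bigLam ε₀ * fluxConst α * S ^ 2 / (1 + Γ))) := by
      field_simp
    rw [e] at hmain
    exact le_of_mul_le_mul_left hmain hexpσ
  have hGη : G * (η / (2 * G)) = η / 2 := by field_simp
  have hmono : G * (bigLam ε₀ * fluxConst α * S ^ 2 / (1 + Γ))
      ≤ bigLam ε₀ * fluxConst α * G * S ^ 2 / (1 + viscCoef ε₀ νh k σ₀) := by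
    rw [mul_div_assoc', div_le_div_iff₀ hΓ1 hv1]
    have hnum : 0 ≤ G * (bigLam ε₀ * fluxConst α * S ^ 2) := by positivity
    nlinarith
  calc ‖W k σ‖ ≤ G * (η / (2 * G)) + G * (bigLam ε₀ * fluxConst α * S ^ 2 / (1 + Γ)) := hdiv
    _ ≤ η / 2 + bigLam ε₀ * fluxConst α * G * S ^ 2 / (1 + viscCoef ε₀ νh k σ₀) := by
        rw [hGη]; linarith
    _ < bigLam ε₀ * fluxConst α * G * S ^ 2 / (1 + viscCoef ε₀ νh k σ₀) + η := by linarith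

/-- **Decay above the dissipation cutoff.**  If `‖W_{k₀}‖ ≤ S` on `(-∞, σ₀]` and the damping of the
next shell beats the feed, `2 Λ C_A e^{C_AM/Λ} S ≤ 1 + viscCoef(k₀+1, σ₀)`, then
`‖W_{k₀+j}‖ ≤ S / 2^j` on `(-∞, σ₀]` for every `j` (the thresholds only improve upward:
`viscCoef` grows with the shell, `S/2^j` shrinks).  So the FAR dissipation range of an admissible
eternal solution is slaved to the shells at the cutoff; together with the persistence bound below the
cutoff (`WakeRatchetPersistence`) this leaves, of the viscous crux, exactly the layer
`1 ≲ viscCoef ≲ ΛC_A e^{C_AM/Λ}·(amplitude)` under the cutoff.  MODEL lattice only.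
[cite: Tao2016AveragedNS, §4 Lemma 4.1 (4.8)–(4.10), Thm. 4.2 (statement shape), §6.4; cell vocabulary] -/
theorem sup_le_div_two_pow_above_cutoff (hε : 0 < ε₀) (hc : IsCancellingCoeff α)
    (hW : IsEternalVisc ε₀ νh α W)
    {M : ℝ} (hM : ∀ n : ℤ, Integrable (fun σ => ‖W n σ‖) ∧ ∫ σ, ‖W n σ‖ ≤ M)
    (k₀ : ℤ) {σ₀ S : ℝ} (hS : ∀ s, s ≤ σ₀ → ‖W k₀ s‖ ≤ S)
    (hcut : 2 * bigLam ε₀ * fluxConst α * Real.exp (fluxConst α * (bigLam ε₀)⁻¹ * M) * S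
      ≤ 1 + viscCoef ε₀ νh (k₀ + 1) σ₀) :
    ∀ (j : ℕ) (s : ℝ), s ≤ σ₀ → ‖W (k₀ + j) s‖ ≤ S / 2 ^ j := by
  have hS' := table_sTable α hc
  have hΛpos : 0 < bigLam ε₀ := bigLam_pos (by linarith)
  have hCA : 0 ≤ fluxConst α := hS'.CA_nonneg
  have hv0 : ∀ j s, 0 ≤ viscCoef ε₀ νh j s := fun j s => by
    unfold viscCoef; exact mul_nonneg hW.nonneg (by positivity)
  have hSnn : 0 ≤ S := (norm_nonneg _).trans (hS σ₀ le_rfl)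
  set K₀ : ℝ := bigLam ε₀ * fluxConst α * Real.exp (fluxConst α * (bigLam ε₀)⁻¹ * M) with hK₀
  have hK₀0 : 0 ≤ K₀ := by positivity
  intro j
  induction j with
  | zero => intro s hs; simpa using hS s hs
  | succ j ih =>
    intro s hs
    have hstep := dissipativeStep hε hc hW hM (k₀ + j + 1) (σ₀ := σ₀) (S := S / 2 ^ j)
      (fun s' hs' => by rw [add_sub_cancel_right]; exact ih s' hs') s hs
    have e : k₀ + ((j + 1 : ℕ) : ℤ) = k₀ + j + 1 := by push_cast; ring
    rw [e]
    refine hstep.trans ?_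
    -- `viscCoef(k₀+j+1) ≥ viscCoef(k₀+1)` and `K₀ (S/2^j)² / (1+Γ) ≤ (S/2^j)/2`
    have hΓ : 1 + viscCoef ε₀ νh (k₀ + 1) σ₀ ≤ 1 + viscCoef ε₀ νh (k₀ + j + 1) σ₀ := by
      have := viscCoef_mono_shell hε hW.nonneg (show k₀ + 1 ≤ k₀ + j + 1 by
        have : (0 : ℤ) ≤ j := Int.natCast_nonneg j
        linarith) σ₀
      linarith
    have hv1 : 0 < 1 + viscCoef ε₀ νh (k₀ + 1) σ₀ := by linarith [hv0 (k₀ + 1) σ₀]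
    have hv2 : 0 < 1 + viscCoef ε₀ νh (k₀ + j + 1) σ₀ := by linarith
    have h2j : 0 < (2 : ℝ) ^ j := by positivity
    have hSj : 0 ≤ S / 2 ^ j := by positivity
    have hSjle : S / 2 ^ j ≤ S := div_le_self hSnn (one_le_pow₀ (by norm_num))
    -- `K₀ (S/2^j) ≤ K₀ S ≤ (1+Γ₁)/2`
    have hKS : K₀ * (S / 2 ^ j) ≤ (1 + viscCoef ε₀ νh (k₀ + j + 1) σ₀) / 2 := by
      have := mul_le_mul_of_nonneg_left hSjle hK₀0
      have h' : 2 * K₀ * S ≤ 1 + viscCoef ε₀ νh (k₀ + 1) σ₀ := by rw [hK₀]; linarith [hcut]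
      linarith
    rw [div_le_iff₀ hv2]
    have e2 : S / 2 ^ (j + 1) * (1 + viscCoef ε₀ νh (k₀ + j + 1) σ₀)
        = (S / 2 ^ j) * ((1 + viscCoef ε₀ νh (k₀ + j + 1) σ₀) / 2) := by
      rw [pow_succ]; field_simp
    rw [e2]
    calc K₀ * (S / 2 ^ j) ^ 2 = (S / 2 ^ j) * (K₀ * (S / 2 ^ j)) := by ring
      _ ≤ (S / 2 ^ j) * ((1 + viscCoef ε₀ νh (k₀ + j + 1) σ₀) / 2) :=
          mul_le_mul_of_nonneg_left hKS hSj

end Dissipative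

end WakeRatchetDissipativeStep

end Summit.NavierStokesRegularity.NavierStokesRegularity.Theorems

end
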